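/-
Copyright (c) 2026 the pub-hodgecm-mathlib formalisation cell (harness21).  Prover seat hodgecm-mathlib-K2Liu-p07 (g3), Track B «K2-LIT»,
#184♮ = hLiu418 = `stmt-HodgeConjecture-24832`; #42S payer road, organ S1 (local Siegel–Weil spanning), ROAD W, file F5′-A2 (LEAD F0P6-plan (g14)
RULING «M-158a» (4): the SIMILITUDE TRANSPORT currency; sequel of F5′-A1 `K2LiuLocalSWSimilitudeAlgebra`).
-/
import Summits.HodgeConjecture.HodgeConjecture.Theorems.K2LiuLocalSWSimilitudeAlgebra   -- ★ F5′-A1: the letter `D₀ = e₂ ∘ S_a`, `coe_inv_dA`, `simMat_map`, `transpose_dA_mul_gramD_mul_dA`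
import HarnessLib

/-!
# Crux `HLiu418`, #42S organ S1, ROAD W, file F5′-A2: THE SYMPLECTIC ELEMENT `P_a = Res(d_a) ∘ e′_a⁻¹ ∈ Sp(𝕎^𝔻_v)` OF THE `Δ`-SIMILITUDE AND `P_a ℓ_Δ = ℓ_Δ`

Cell `hodgecm-mathlib`, crux item hLiu418 = `stmt-HodgeConjecture-24832`; squad K2 ∕ K2Liu; LEAD F0P6-plan (g14), organ lead K2Liu-p06 (g4); prover
K2Liu-p07 (g3).  THEOREMS ONLY (no `def`, no instance, no notation, no named-fact hypothesis, no `sorry`); lane `--supports stmt-HodgeConjecture-24832 --as helper`.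

WHY.  File F5′-B proves the Kudla rigidity `P̃_a⁻¹ · Σ_χ(d_a g d_a⁻¹) · P̃_a = scaleTransport_a(Σ′_χ)(g)` (the local Weil datum of `(𝔻, a·h)` read through the
similitude `d_a = (1 on Δ, a on ∇)`, ruling «M-158a» (4)) by the template ★ P3c `localSplittingDatumCM_localCongr_kd_eq_scaleTransportSection`, whose two
KD-specific inputs are (a) a symplectic element `P` with `P · ι_{δ∕a}(g) · P⁻¹ = ι_δ(Ad g)` — ★ P3b `conj_iota_lineDelta_eq_iota_localCongr_kd` is generic in the
similitude, it only needs `P = Res(DA_v) ∘ e′_a⁻¹` to be symplectic — and (b) `P ℓ_Δ = ℓ_Δ` (so that `P̃⁻¹` carries movers to movers).  This file supplies both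
for `KD := DA` (the exact analogue of ★ P3b `LocalDoubledRationalSimilitudeSymplectic` §2–§3 for `d_a` in place of `k ⊕ k`):
* `isometry_toLocalGL_dA`: `ᵗ(c DA_v) · (𝕋^𝔻_v ⊗ 1) · DA_v = 𝕋^𝔻′_v ⊗ 1` with `T₀′ = a·T₀`;
* **`exists_symplectic_dA`**: `P_a := Res(DA_v) ∘ e′_a⁻¹ ∈ Sp(𝕎^𝔻_v, β_{T^𝔻})`;
* `resAut_toLocalGL_dA(_inv)`: `Res(DA_v)^{±1}(p, q) = (S_{a^{±1},v} p, S_{a^{±1},v} q)`; **`map_deltaLagrangian_symplectic_dA`**: `P_a ℓ_Δ = ℓ_Δ` (`d_a` is the identity on `Δ`,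
  `e′_a` rescales the `δ`-coordinates uniformly).
References: [Kudla1994] §2, §3 Thm. 3.1; [HarrisKudlaSweet1996] §1 (1.9)–(1.11); [MoeglinVignerasWaldspurger1987] Chap. 1 I.17; [Weil1964] n° 34 p. 182 (`e′_a`).
HONEST LABEL.  Count-neutral helper: `HC_CM` is proved only modulo the 7 printed citations (2 remaining named inputs: hLiu418 = `stmt-HodgeConjecture-24832`,
h413 = `stmt-HodgeConjecture-24833`) until rung 0 closes.
-/

set_option autoImplicit false
set_option linter.dupNamespace false -- the mandated namespace repeats `HodgeConjecture.HodgeConjecture`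

noncomputable section

open scoped Matrix
open NumberField IsDedekindDomain Matrix
open Literature.NumberTheory.Automorphic Literature.NumberTheory.Automorphic.UnitaryGroup Literature.NumberTheory.Weil1964
open Literature.NumberTheory.GelbartRogawski1991.AdaptedBlocks
open Literature.NumberTheory.GelbartRogawski1991.UnitaryDualPair.LocalSplitting
open Literature.RepresentationTheory.HeisenbergGroup
open Summit.HodgeConjecture.HodgeConjecture.Cruxes.HLiu418.K2LiuLocalSWSimilitudeAlgebra

namespace Summit.HodgeConjecture.HodgeConjecture.Cruxes.HLiu418.K2LiuLocalSWSimilitudeSymplectic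

/-- coercion of `GeneralLinearGroup.map` (definitional). [folklore] -/
private theorem coe_glMap {R S : Type*} [CommRing R] [CommRing S] {l : Type*} [Fintype l] [DecidableEq l] (f : R →+* S) (g : GL l R) :
    ((Matrix.GeneralLinearGroup.map f g : GL l S) : Matrix l l S) = (g : Matrix l l R).map f := rfl

variable (F : Type) [Field F] [NumberField F] (E : Type) [Field E] [NumberField E] [Algebra F E]
  (c : E ≃ₐ[F] E) (v : HeightOneSpectrum (𝓞 F)) (n : ℕ) {T₀ : Matrix (Fin n) (Fin n) F}
  {JD : Matrix (Fin (n + n)) (Fin (n + n)) E} (hJD : JD = (gramD F n T₀).map (algebraMap F E))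
  (a : Fˣ) {D₀ : GL (Fin (n + n)) F}
  (hD₀ : (D₀ : Matrix (Fin (n + n)) (Fin (n + n)) F) =
    Matrix.reindex (e₂ n) (e₂ n) (cayR F (Fin n) * Matrix.fromBlocks 1 0 0 ((a : F) • (1 : Matrix (Fin n) (Fin n) F)) * cayRinv F (Fin n)))
  {DA : GL (Fin (n + n)) E} (hDA : DA = Matrix.GeneralLinearGroup.map (algebraMap F E) D₀)

/-! ## §1 The symplectic element `P_a = Res(DA_v) ∘ e′_a⁻¹` and `P_a ℓ_Δ = ℓ_Δ` -/

section Symplectic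

variable [Algebra.IsQuadraticExtension F E] {δ : E} (hcδ : c δ = -δ) (hδ : δ ≠ 0) {d : F} (hd : δ * δ = algebraMap F E d)
  {T₀' : Matrix (Fin n) (Fin n) F} (hT₀ : T₀.IsSymm) (hTT₀ : T₀' = (a : F) • T₀)

omit [Algebra.IsQuadraticExtension F E] in
/-- a RATIONAL matrix read in `GL_N(E ⊗ F_v)` is the `F_v`-matrix read through `ι_v : F_v → E ⊗ F_v`. [folklore] -/
private theorem toLocalGL_map_eq' {N : ℕ} (B₀ : GL (Fin N) F) :
    toLocalGL E v (Matrix.GeneralLinearGroup.map (algebraMap F E) B₀) =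
      Matrix.GeneralLinearGroup.map (toLocalRing E v) (Matrix.GeneralLinearGroup.map (algebraMap F (v.adicCompletion F)) B₀) := by
  refine Units.ext (Matrix.ext fun i j => ?_)
  exact (toLocalRing_coe E v ((B₀ : Matrix (Fin N) (Fin N) F) i j)).symm

omit [Algebra.IsQuadraticExtension F E] in
include hD₀ hDA hTT₀ in
/-- **`DA_v` is an isometry `(E_v^{n+n}, a·J^𝔻) → (E_v^{n+n}, J^𝔻)`** read on the local form matrices `𝕋^𝔻_v ⊗ 1`, `𝕋^𝔻′_v ⊗ 1` (`T₀′ = a·T₀`).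
[cite: MoeglinVignerasWaldspurger1987, Chap. 1 I.17] [cite: HarrisKudlaSweet1996, §1 (1.9)] -/
theorem isometry_toLocalGL_dA :
    (((toLocalGL E v DA).val : Matrix (Fin (n + n)) (Fin (n + n)) (LocalRing E v)).map (conjLocal E c v))ᵀ *
        (localGram F (n + n) (gramD F n T₀) v).map (toLocalRing E v) * (toLocalGL E v DA).val =
      (localGram F (n + n) (gramD F n T₀') v).map (toLocalRing E v) := by
  subst hDA
  rw [toLocalGL_map_eq', coe_glMap, coe_glMap]
  have hcφ : (conjLocal E c v : LocalRing E v → LocalRing E v) ∘ (toLocalRing E v) = toLocalRing E v := funext fun x => conjLocal_toLocalRing c v x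
  rw [Matrix.map_map, hcφ, ← Matrix.transpose_map, ← Matrix.map_mul, ← Matrix.map_mul, localGram, ← Matrix.transpose_map, ← Matrix.map_mul,
    ← Matrix.map_mul, transpose_dA_mul_gramD_mul_dA F n a hD₀, localGram_of_eq_smul F (n + n) (gramD F n T₀) (gramD F n T₀') a
      (by rw [hTT₀, gramD_smul]) v, localGram, Matrix.map_smul' _ _ _ (map_mul _)]

include hD₀ hDA hTT₀ hT₀ in
/-- **`P_a := Res(DA_v) ∘ e′_a⁻¹` lies in `Sp(𝕎^𝔻_v, β_{T^𝔻})`**: `e′_a⁻¹` is an isometry `β_{T^𝔻} → β_{aT^𝔻}` (★ `polar_localPairing_lineScale_of_eq_smul`) and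
`Res(DA_v)` an isometry `β_{aT^𝔻} → β_{T^𝔻}` (★ `alt_polar_resAut`). [cite: MoeglinVignerasWaldspurger1987, Chap. 1 I.17] [cite: Weil1964, n° 34 p. 182] -/
theorem exists_symplectic_dA :
    ∃ P : LocalSp F (n + n) (gramD F n T₀) v,
      ((P : ((Fin (n + n) → v.adicCompletion F) × (Fin (n + n) → v.adicCompletion F)) ≃ₗ[v.adicCompletion F]
          ((Fin (n + n) → v.adicCompletion F) × (Fin (n + n) → v.adicCompletion F))) =
        (lineScale (unitAt F a v)).symm ≪≫ₗ (isQuadraticCoordinates_local E v c hcδ hδ hd).resAut (Fin (n + n)) (toLocalGL E v DA)) := by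
  refine ⟨⟨(lineScale (unitAt F a v)).symm ≪≫ₗ (isQuadraticCoordinates_local E v c hcδ hδ hd).resAut (Fin (n + n)) (toLocalGL E v DA), ?_⟩, rfl⟩
  rw [mem_symplecticGroup]
  intro w w'
  have hres := fun p q => (isQuadraticCoordinates_local E v c hcδ hδ hd).alt_polar_resAut (Fin (n + n))
    ((gramD_isSymm F n hT₀).map (algebraMap F (v.adicCompletion F)))
    ((gramD_isSymm F n (T₀ := T₀') (by rw [hTT₀]; exact hT₀.smul _)).map (algebraMap F (v.adicCompletion F)))
    (σ := conjLocal E c v) (conjLocal_toLocalRing c v) (by rw [conjLocal_algebraMap, hcδ, map_neg]) rfl rfl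
    (isometry_toLocalGL_dA F E c v n a hD₀ hDA hTT₀) p q
  simp only [alt_apply] at hres
  rw [LinearEquiv.trans_apply, LinearEquiv.trans_apply]
  change polar (localPairing F (n + n) (gramD F n T₀) v) _ _ - polar (localPairing F (n + n) (gramD F n T₀) v) _ _ =
    polar (localPairing F (n + n) (gramD F n T₀) v) _ _ - polar (localPairing F (n + n) (gramD F n T₀) v) _ _
  rw [localPairing, hres, ← localPairing,
    ← polar_localPairing_lineScale_of_eq_smul F (n + n) (gramD F n T₀) (gramD F n T₀') a (by rw [hTT₀, gramD_smul]) v,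
    ← polar_localPairing_lineScale_of_eq_smul F (n + n) (gramD F n T₀) (gramD F n T₀') a (by rw [hTT₀, gramD_smul]) v
      ((lineScale (unitAt F a v)).symm w'),
    LinearEquiv.apply_symm_apply, LinearEquiv.apply_symm_apply]

omit [Algebra.IsQuadraticExtension F E] in
/-- `(reindex e₂ e₂ (A B; C D)) x` has halves `A x_L + B x_R`, `C x_L + D x_R`. [folklore] -/
private theorem halves_reindex_fromBlocks_mulVec₄ (A B C D : Matrix (Fin n) (Fin n) (v.adicCompletion F)) (x : Fin (n + n) → v.adicCompletion F) :
    halfL F v n (Matrix.reindex (e₂ n) (e₂ n) (Matrix.fromBlocks A B C D) *ᵥ x) = A *ᵥ halfL F v n x + B *ᵥ halfR F v n x ∧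
      halfR F v n (Matrix.reindex (e₂ n) (e₂ n) (Matrix.fromBlocks A B C D) *ᵥ x) = C *ᵥ halfL F v n x + D *ᵥ halfR F v n x := by
  have hx : x ∘ (e₂ n) = Sum.elim (halfL F v n x) (halfR F v n x) := by funext s; rcases s with i | i <;> rfl
  rw [Matrix.reindex_apply, Matrix.submatrix_mulVec_equiv, Equiv.symm_symm, hx, Matrix.fromBlocks_mulVec]
  exact ⟨funext fun i => by simp only [halfL, Function.comp_apply, Equiv.symm_apply_apply, Sum.elim_inl, Sum.elim_comp_inl, Sum.elim_comp_inr],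
    funext fun i => by simp only [halfR, Function.comp_apply, Equiv.symm_apply_apply, Sum.elim_inr, Sum.elim_comp_inl, Sum.elim_comp_inr]⟩

omit [Algebra.IsQuadraticExtension F E] in
/-- `(e₂ ∘ S_t, s • (e₂ ∘ S_t))` maps `ℓ_Δ` into `ℓ_Δ` (`S_t` fixes diagonal vectors: `(α + β) x_L` on both halves). [cite: HarrisKudlaSweet1996, §1 (1.11)] -/
private theorem mem_deltaLagrangian_of_dA (t s : v.adicCompletion F) {x y : Fin (n + n) → v.adicCompletion F} (hp : (x, y) ∈ deltaLagrangian F v n) :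
    (Matrix.reindex (e₂ n) (e₂ n) (cayR (v.adicCompletion F) (Fin n) * Matrix.fromBlocks 1 0 0 (t • (1 : Matrix (Fin n) (Fin n) (v.adicCompletion F))) *
        cayRinv (v.adicCompletion F) (Fin n)) *ᵥ x,
      Matrix.reindex (e₂ n) (e₂ n) (cayR (v.adicCompletion F) (Fin n) * Matrix.fromBlocks 1 0 0 (t • (1 : Matrix (Fin n) (Fin n) (v.adicCompletion F))) *
        cayRinv (v.adicCompletion F) (Fin n)) *ᵥ (s • y)) ∈ deltaLagrangian F v n := by
  rw [mem_deltaLagrangian_iff] at hp ⊢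
  obtain ⟨h1, h2⟩ := hp
  have h2' : halfL F v n (s • y) = halfR F v n (s • y) := by
    funext i
    change s * y _ = s * y _
    rw [show y (e₂ n (Sum.inl i)) = halfL F v n y i from rfl, h2]
  rw [simMat_eq_fromBlocks]
  refine ⟨?_, ?_⟩
  · rw [(halves_reindex_fromBlocks_mulVec₄ F v n _ _ _ _ x).1, (halves_reindex_fromBlocks_mulVec₄ F v n _ _ _ _ x).2, h1, add_comm]
  · rw [(halves_reindex_fromBlocks_mulVec₄ F v n _ _ _ _ _).1, (halves_reindex_fromBlocks_mulVec₄ F v n _ _ _ _ _).2, h2', add_comm]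

include hD₀ hDA in
/-- `Res(DA_v)(p, q) = (S_{a,v} p, S_{a,v} q)` with `S_{a,v} = e₂ ∘ S_a` over `F_v`. [cite: MoeglinVignerasWaldspurger1987, Chap. 1 I.17] -/
theorem resAut_toLocalGL_dA (p q : Fin (n + n) → v.adicCompletion F) :
    (isQuadraticCoordinates_local E v c hcδ hδ hd).resAut (Fin (n + n)) (toLocalGL E v DA) (p, q) =
      (Matrix.reindex (e₂ n) (e₂ n) (cayR (v.adicCompletion F) (Fin n) *
          Matrix.fromBlocks 1 0 0 (((a : F) : v.adicCompletion F) • (1 : Matrix (Fin n) (Fin n) (v.adicCompletion F))) * cayRinv (v.adicCompletion F) (Fin n)) *ᵥ p,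
        Matrix.reindex (e₂ n) (e₂ n) (cayR (v.adicCompletion F) (Fin n) *
          Matrix.fromBlocks 1 0 0 (((a : F) : v.adicCompletion F) • (1 : Matrix (Fin n) (Fin n) (v.adicCompletion F))) * cayRinv (v.adicCompletion F) (Fin n)) *ᵥ q) := by
  rw [hDA, resAut_toLocalGL_map F E c v hcδ hδ hd (n + n), hD₀, Matrix.reindex_apply, Matrix.reindex_apply, ← Matrix.submatrix_map, simMat_map]
  rfl

include hD₀ hDA in
/-- `Res(DA_v)⁻¹(p, q) = (S_{a⁻¹,v} p, S_{a⁻¹,v} q)`. [cite: MoeglinVignerasWaldspurger1987, Chap. 1 I.17] -/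
theorem resAut_toLocalGL_dA_inv (p q : Fin (n + n) → v.adicCompletion F) :
    ((isQuadraticCoordinates_local E v c hcδ hδ hd).resAut (Fin (n + n)) (toLocalGL E v DA))⁻¹ (p, q) =
      (Matrix.reindex (e₂ n) (e₂ n) (cayR (v.adicCompletion F) (Fin n) *
          Matrix.fromBlocks 1 0 0 ((((a⁻¹ : Fˣ) : F) : v.adicCompletion F) • (1 : Matrix (Fin n) (Fin n) (v.adicCompletion F))) * cayRinv (v.adicCompletion F) (Fin n)) *ᵥ p,
        Matrix.reindex (e₂ n) (e₂ n) (cayR (v.adicCompletion F) (Fin n) *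
          Matrix.fromBlocks 1 0 0 ((((a⁻¹ : Fˣ) : F) : v.adicCompletion F) • (1 : Matrix (Fin n) (Fin n) (v.adicCompletion F))) * cayRinv (v.adicCompletion F) (Fin n)) *ᵥ q) := by
  rw [← map_inv, ← map_inv]
  exact resAut_toLocalGL_dA F E c v n a⁻¹ (coe_inv_dA F n a hD₀) (by rw [hDA, map_inv]) hcδ hδ hd p q

include hD₀ hDA in
set_option maxHeartbeats 1600000 in -- as ★ `map_deltaLagrangian_symplectic_kd` (the `≃ₗ` coercions of `LocalSp` elaborate slowly)
/-- **`P_a ℓ_Δ = ℓ_Δ`** for `P_a = Res(DA_v) ∘ e′_a⁻¹` (`d_a` is the identity on `Δ`; `e′_a` rescales the `δ`-coordinates uniformly).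
[cite: Kudla1994, §2] [cite: HarrisKudlaSweet1996, §1 (1.11)] -/
theorem map_deltaLagrangian_symplectic_dA (P : LocalSp F (n + n) (gramD F n T₀) v)
    (hP : ((P : ((Fin (n + n) → v.adicCompletion F) × (Fin (n + n) → v.adicCompletion F)) ≃ₗ[v.adicCompletion F]
          ((Fin (n + n) → v.adicCompletion F) × (Fin (n + n) → v.adicCompletion F))) =
        (lineScale (unitAt F a v)).symm ≪≫ₗ (isQuadraticCoordinates_local E v c hcδ hδ hd).resAut (Fin (n + n)) (toLocalGL E v DA))) :
    (deltaLagrangian F v n).map (toLin F v P) = deltaLagrangian F v n := by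
  have key : ∀ p, toLin F v P p =
      (P : ((Fin (n + n) → v.adicCompletion F) × (Fin (n + n) → v.adicCompletion F)) ≃ₗ[v.adicCompletion F] _) p := fun _ => rfl
  have hfwd : ∀ x y : Fin (n + n) → v.adicCompletion F, (x, y) ∈ deltaLagrangian F v n →
      (P : ((Fin (n + n) → v.adicCompletion F) × (Fin (n + n) → v.adicCompletion F)) ≃ₗ[v.adicCompletion F] _) (x, y) ∈ deltaLagrangian F v n := by
    intro x y hp
    rw [hP, LinearEquiv.trans_apply, lineScale_symm_apply, resAut_toLocalGL_dA F E c v n a hD₀ hDA hcδ hδ hd]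
    exact mem_deltaLagrangian_of_dA F v n _ _ hp
  have hbwd : ∀ x y : Fin (n + n) → v.adicCompletion F, (x, y) ∈ deltaLagrangian F v n →
      (P : ((Fin (n + n) → v.adicCompletion F) × (Fin (n + n) → v.adicCompletion F)) ≃ₗ[v.adicCompletion F] _).symm (x, y) ∈
        deltaLagrangian F v n := by
    intro x y hp
    rw [hP, LinearEquiv.trans_symm, LinearEquiv.trans_apply, LinearEquiv.symm_symm]
    have hinv : ((isQuadraticCoordinates_local E v c hcδ hδ hd).resAut (Fin (n + n)) (toLocalGL E v DA)).symm (x, y) =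
        ((isQuadraticCoordinates_local E v c hcδ hδ hd).resAut (Fin (n + n)) (toLocalGL E v DA))⁻¹ (x, y) := rfl
    rw [hinv, resAut_toLocalGL_dA_inv F E c v n a hD₀ hDA hcδ hδ hd, lineScale_apply, ← Matrix.mulVec_smul]
    exact mem_deltaLagrangian_of_dA F v n _ _ hp
  refine le_antisymm ?_ ?_
  · rintro _ ⟨⟨x, y⟩, hp, rfl⟩
    rw [key]
    exact hfwd x y hp
  · rintro ⟨x, y⟩ hp
    refine ⟨(P : ((Fin (n + n) → v.adicCompletion F) × (Fin (n + n) → v.adicCompletion F)) ≃ₗ[v.adicCompletion F] _).symm (x, y), ?_, ?_⟩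
    · have h := hbwd x y hp
      revert h
      rcases (P : ((Fin (n + n) → v.adicCompletion F) × (Fin (n + n) → v.adicCompletion F)) ≃ₗ[v.adicCompletion F] _).symm (x, y) with ⟨x', y'⟩
      exact id
    · rw [key]
      exact (P : ((Fin (n + n) → v.adicCompletion F) × (Fin (n + n) → v.adicCompletion F)) ≃ₗ[v.adicCompletion F] _).apply_symm_apply (x, y)

end Symplectic

end Summit.HodgeConjecture.HodgeConjecture.Cruxes.HLiu418.K2LiuLocalSWSimilitudeSymplectic

end
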